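import Literature.MathematicalPhysics.QuantumFieldTheory.ConformalBootstrap3D.PointKernelK57Data
import Literature.MathematicalPhysics.QuantumFieldTheory.ConformalBootstrap3D.PointKernelParts

/-!
# K57 certificate, kernel part file P6: one-cell head segments 148 in level ranges

The head cells whose kernel evaluation exceeds one `decide` are one-cell segments of `hsegsK57`; each is
checked by `PCert.hPartSideOK` (side conditions) and `PCert.hPartOK` per level range `[n_lo, n_lo + count)`
against an integer claim, the claims summing to `≥ 0` (`PointKernel.partsOK`); soundness is
`PCert.hParts_sound` (`PointKernelParts`).  The part files `P1, P2, …` are mutually independent (each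
imports only the data file); the ranges of one cell may span several of them, and the per-cell
conclusions `hparts_i` / `hcell_i` of those cells are assembled in `PointKernelK57.lean`.
Estimated kernel time 197 s.
-/

set_option maxRecDepth 100000
set_option maxHeartbeats 0

namespace Literature.MathematicalPhysics.QuantumFieldTheory.ConformalBootstrap3D.PointKernelK57

open Literature.MathematicalPhysics.QuantumFieldTheory.ConformalBootstrap3D.PointKernel

/-- one-cell segment 148 (row 6, cell `[3585/512, 1793/256]`, chord, `n_F = 64`,
13 level ranges): side conditions. [folklore] -/
theorem pside_148 : certK57.hPartSideOK (PCert.segAt hsegsK57 148) JHK57 = true := by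
  decide +kernel

/-- its level ranges `(n_lo, count, claim)`. [folklore] -/
def parts_148 : List (ℕ × ℕ × ℤ) := [(0, 20, -19491845474512450794342278844332507142), (20, 9, 10257445993358541790268628965107188025), (29, 7, 4939809987485924313938410674961728476), (36, 5, 1917107219990549340718731318194040488), (41, 4, 934812225880707303621387044198949996), (45, 4, 597149649078434246995882920432616499), (49, 3, 298444716696551150466801718150271249), (52, 3, 211073569406471389187496367174905323), (55, 3, 148700944574782585439117512640000543), (58, 2, 71876925426383581070541895198044232), (60, 2, 56216128156581365537207912607597671), (62, 2, 43737704675795425764379291813239840), (64, 1, 15470409781728301333693223853924807)]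

/-- the ranges tile `[0, n_F]` and the claims sum to `≥ 0`. [folklore] -/
theorem pcov_148 : PointKernel.partsOK 64 parts_148 = true := by
  decide +kernel

/-- levels `[0, 20)` of segment 148: partial lower sum `≥` claim. [folklore] -/
theorem part_148_0 : certK57.hPartOK (PCert.segAt hsegsK57 148) JHK57 0 20 (-19491845474512450794342278844332507142) = true := by
  decide +kernel

/-- levels `[20, 29)` of segment 148: partial lower sum `≥` claim. [folklore] -/
theorem part_148_1 : certK57.hPartOK (PCert.segAt hsegsK57 148) JHK57 20 9 (10257445993358541790268628965107188025) = true := by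
  decide +kernel

/-- levels `[29, 36)` of segment 148: partial lower sum `≥` claim. [folklore] -/
theorem part_148_2 : certK57.hPartOK (PCert.segAt hsegsK57 148) JHK57 29 7 (4939809987485924313938410674961728476) = true := by
  decide +kernel

end Literature.MathematicalPhysics.QuantumFieldTheory.ConformalBootstrap3D.PointKernelK57
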